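import Summits.Ventures.Crystal3D.Theorems.StickyWulffConstantGenericWallFloorStackLedgerOneSidedPool
import HarnessLib

/-!
# The priced one-sided ledger, part 2: the `λ = 1` sanity check and the per-pair packagings
# (crux `GenericWallFloor`, stmt-Ventures-19480, line `WallLedgerG`)

HONEST FRAMING. Venture `Summits/Ventures/Crystal3D` (cell `crystal3d-full`), helper `--supports` the crux `GenericWallFloor`
(stmt-Ventures-19480) of `route-Ventures-StickyWulffConstant`, registered line `WallLedgerG`, open stub `stub_twoSlabAdhesion`.
Rung credit only; F-C1 not moved; NOT the stub; `hdirs` and `hpool` remain hypotheses.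

* **`pool_of_count`** — the landed count lemma (`card_contacts_add_endStates_le_twelve_sep`, empty second family) discharges the pool
  hypothesis of `…StackLedgerOneSidedPool` at `λ = 1` for any finite set of certified end states of one family: the priced ledger at
  `λ = 1` IS `twoSlabAdhesion_stackLedger_oneSided_dirs` (sanity of the cut);
* **`twoSlabLedgerAt_oneSided_pool`**, **`genericWallFloorAtCharge_oneSided_pool`** — the per-pair packagings at charge
  `λ·½·√2|⟪A₁u₁,e₃⟫|` (modulo E1, `StarPairFar`, `hdirs`, `hpool`).
WHAT THIS IS NOT: no discharge of `hpool` for any `λ > 1` (the §51 side's obligation); F-C1 not moved.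
-/

noncomputable section

namespace Summit.Ventures.Crystal3D.Theorems

open Summit.Ventures.Crystal3D Finset
open Literature.MathematicalPhysics.StatisticalMechanics (fccStacking barlowStacking IsHaggSeq contactDeficiency)
open scoped InnerProductSpace

variable {X : Finset (EuclideanSpace ℝ (Fin 3))}

/-! ### Sanity of the cut: the landed count discharges the pool hypothesis at `λ = 1` -/

open scoped Classical in
/-- **`hpool` at `λ = 1` from the count lemma**: for any finite set of inner certified end states of ONE family (pairwise distinct
states; deficient balls in the payer window), `#ES ≤ Σ_{PAY} (12 − deg)` — `card_contacts_add_endStates_le_twelve_sep` with an empty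
second family, summed fibrewise over the end balls.  So `twoSlabAdhesion_stackLedger_oneSided_dirs` is the instance `λ = 1` of the
priced ledger. -/
theorem pool_of_count (hX : ∀ p ∈ X, ∀ q ∈ X, p ≠ q → 1 ≤ dist p q)
    (hDS : ∀ F₁ F₂ : EuclideanSpace ℝ (Fin 3) ≃ₗᵢ[ℝ] EuclideanSpace ℝ (Fin 3), DoubleStarCoaxialAt F₁ F₂) (hCP : CapPairCoaxial)
    (M₁ : Set (EuclideanSpace ℝ (Fin 3) ≃ₗᵢ[ℝ] EuclideanSpace ℝ (Fin 3)))
    {z : EuclideanSpace ℝ (Fin 3)} {A₁ : EuclideanSpace ℝ (Fin 3) ≃ₗᵢ[ℝ] EuclideanSpace ℝ (Fin 3)} {u₁ : EuclideanSpace ℝ (Fin 3)}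
    (hu₁ : u₁ ∈ fccSlots) (lo hi : ℝ) (ES : Finset (EuclideanSpace ℝ (Fin 3) × List WalkEntry))
    (hES : ∀ s ∈ ES, s.1 ∈ X ∧ (lo ≤ s.1 2 ∧ s.1 2 ≤ hi) ∧ (X.filter fun q => dist s.1 q = 1).card ≤ 11 ∧
      WalkInv X z s ∧ StackWF z s.2 ∧ s.2.getLast? = some ⟨A₁, u₁, 0⟩ ∧
      (∃ e rest, s.2 = e :: rest ∧ WalkCertified12 X s.1 e) ∧ (∀ e ∈ s.2, e.frame ∈ M₁)) :
    (1 : ℝ) * (ES.card : ℝ) ≤ ∑ y ∈ X.filter (fun y => (X.filter fun q => dist y q = 1).card ≠ 12 ∧ lo ≤ y 2 ∧ y 2 ≤ hi),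
      ((12 : ℝ) - ((X.filter fun q => dist y q = 1).card : ℝ)) := by
  set e₃ : EuclideanSpace ℝ (Fin 3) := EuclideanSpace.single (2 : Fin 3) (1 : ℝ) with he₃
  set PAY := X.filter (fun y => (X.filter fun q => dist y q = 1).card ≠ 12 ∧ lo ≤ y 2 ∧ y 2 ≤ hi) with hPAY
  have hu₁0 : A₁ u₁ ≠ 0 := fun h0 => by
    have := norm_eq_one_of_mem_fccSlots hu₁; rw [← LinearIsometryEquiv.norm_map A₁, h0, norm_zero] at this
    exact zero_ne_one this
  have hbb : (⟨A₁, u₁, 0⟩ : WalkEntry) ≠ ⟨A₁, u₁, A₁ u₁⟩ := fun hb => hu₁0 (congrArg WalkEntry.nrm hb).symm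
  -- every end ball is a payer
  have hmemPAY : ∀ s ∈ ES, s.1 ∈ PAY := by
    intro s hs
    obtain ⟨hyX, hwin, hdeg, -⟩ := hES s hs
    rw [hPAY, Finset.mem_filter]; exact ⟨hyX, by omega, hwin⟩
  -- fibrewise count
  have hsum : ES.card = ∑ y ∈ PAY, (ES.filter fun s => s.1 = y).card :=
    Finset.card_eq_sum_card_fiberwise fun s hs => hmemPAY s hs
  have hpt : ∀ y ∈ PAY, (X.filter fun q => dist y q = 1).card + (ES.filter fun s => s.1 = y).card ≤ 12 := by
    intro y _
    set fib := ES.filter fun s => s.1 = y with hfib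
    by_cases hemp : fib = ∅
    · rw [hemp, Finset.card_empty, add_zero]; exact card_filter_dist_eq_one_le_twelve X hX y
    have hdegy : (X.filter fun q => dist y q = 1).card ≤ 11 := by
      obtain ⟨s, hs⟩ := Finset.nonempty_iff_ne_empty.2 hemp
      obtain ⟨hsE, hsy⟩ := Finset.mem_filter.1 hs
      have := (hES s hsE).2.2.1; rw [hsy] at this; exact this
    have key := card_contacts_add_endStates_le_twelve_sep hX hDS hCP M₁ (∅ : Set _)
      (fun F₁ _ F₂ hF₂ => absurd hF₂ (Set.notMem_empty F₂)) hbb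
      (z₁ := z) (z₂ := -e₃) hdegy fib (∅ : Finset _) (fun s hs => ?_) (fun s hs => absurd hs (Finset.notMem_empty s))
    · rw [Finset.card_empty, add_zero] at key; exact key
    · obtain ⟨hsE, hsy⟩ := Finset.mem_filter.1 hs
      obtain ⟨-, -, -, hI, hW, hlast, hC, hfr⟩ := hES s hsE
      rw [hsy] at hC; exact ⟨hsy, hI, hW, hlast, hC, hfr⟩
  rw [one_mul, hsum]
  push_cast
  refine Finset.sum_le_sum fun y hy => ?_
  have h := hpt y hy
  have h' : ((X.filter fun q => dist y q = 1).card : ℝ) + ((ES.filter fun s => s.1 = y).card : ℝ) ≤ 12 := by exact_mod_cast h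
  linarith

/-! ### Packaging in the per-pair currencies -/

open scoped Classical in
/-- **`TwoSlabLedgerAt (λ·½κ₁)` from grain 1 alone, priced** (modulo E1, `StarPairFar`'s consequences, `hdirs` and `hpool`). -/
theorem twoSlabLedgerAt_oneSided_pool
    {s₀ : EuclideanSpace ℝ (Fin 3)} (hs₀ : s₀ ∈ fccSlots)
    (hcert : ExactOnly 0 (fccSlots.filter fun w => 0 < ⟪w, s₀⟫_ℝ))
    (hDS : ∀ F₁ F₂ : EuclideanSpace ℝ (Fin 3) ≃ₗᵢ[ℝ] EuclideanSpace ℝ (Fin 3), DoubleStarCoaxialAt F₁ F₂)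
    (hCP : CapPairCoaxial)
    (A₁ : EuclideanSpace ℝ (Fin 3) ≃ₗᵢ[ℝ] EuclideanSpace ℝ (Fin 3)) (t₁ : EuclideanSpace ℝ (Fin 3))
    (A₂ : EuclideanSpace ℝ (Fin 3) ≃ₗᵢ[ℝ] EuclideanSpace ℝ (Fin 3)) (t₂ : EuclideanSpace ℝ (Fin 3))
    {z : EuclideanSpace ℝ (Fin 3)} (hz : ‖z‖ = 1)
    {u₁ : EuclideanSpace ℝ (Fin 3)} (hu₁ : u₁ ∈ fccSlots)
    (hsteep₁ : Real.sqrt 2 / 2 ≤ ⟪A₁ u₁, z⟫_ℝ) {δ : ℝ} (hδ : 0 < δ) (hup : δ ≤ (A₁ u₁) 2)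
    (M₁ : Set (EuclideanSpace ℝ (Fin 3) ≃ₗᵢ[ℝ] EuclideanSpace ℝ (Fin 3)))
    (hM₁ : ∀ stk : List WalkEntry, StackSound z stk → StackWF z stk → stk.getLast? = some ⟨A₁, u₁, 0⟩ →
      ∀ e ∈ stk, e.frame ∈ M₁)
    (hfar : ∀ F ∈ M₁, F '' fccStacking 1 (Real.sqrt (2 / 3)) ≠ A₂ '' fccStacking 1 (Real.sqrt (2 / 3)))
    (hdirs : ∀ stk : List WalkEntry, StackSound z stk → StackWF z stk → stk.getLast? = some ⟨A₁, u₁, 0⟩ →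
      ∀ e rest, stk = e :: rest → 0 ≤ (e.frame e.dir) 2)
    {lam : ℝ} (hlam : 0 < lam)
    (hpool : ∀ h : ℝ, 0 ≤ h → ∀ ρ : ℝ, 10 ≤ ρ → ∀ X P₁ P₂ : Finset (EuclideanSpace ℝ (Fin 3)),
      (∀ p ∈ X, ∀ q ∈ X, p ≠ q → 1 ≤ dist p q) → P₁ ⊆ X → P₂ ⊆ X \ P₁ →
      (∀ p ∈ X, -(2 * 10) ≤ p 2 ∧ p 2 ≤ h + 2 * 10 ∧ p 0 ^ 2 + p 1 ^ 2 ≤ ρ ^ 2) →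
      (∀ p, p ∈ P₁ ↔ (p ∈ (fun q => A₁ q + t₁) '' fccStacking 1 (Real.sqrt (2 / 3)) ∧
        -(2 * 10) ≤ p 2 ∧ p 2 ≤ -10 ∧ p 0 ^ 2 + p 1 ^ 2 ≤ ρ ^ 2)) →
      (∀ p, p ∈ P₂ ↔ (p ∈ (fun q => A₂ q + t₂) '' fccStacking 1 (Real.sqrt (2 / 3)) ∧
        h + 10 ≤ p 2 ∧ p 2 ≤ h + 2 * 10 ∧ p 0 ^ 2 + p 1 ^ 2 ≤ ρ ^ 2)) →
      ∀ ES : Finset (EuclideanSpace ℝ (Fin 3) × List WalkEntry),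
      (∀ s ∈ ES, s.1 ∈ X ∧ s.1 0 ^ 2 + s.1 1 ^ 2 ≤ (ρ - 2) ^ 2 ∧ (-10 - 2 ≤ s.1 2 ∧ s.1 2 ≤ h + 10 + 2) ∧
        (X.filter fun q => dist s.1 q = 1).card ≤ 11 ∧ WalkInv X z s ∧ StackWF z s.2 ∧
        s.2.getLast? = some ⟨A₁, u₁, 0⟩ ∧ walkStep X z s = none ∧ (∃ e rest, s.2 = e :: rest ∧ WalkCertified12 X s.1 e) ∧
        (∀ e ∈ s.2, e.frame ∈ M₁)) →
      lam * (ES.card : ℝ) ≤ ∑ y ∈ X.filter (fun y => (X.filter fun q => dist y q = 1).card ≠ 12 ∧ -10 - 2 ≤ y 2 ∧ y 2 ≤ h + 10 + 2),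
        ((12 : ℝ) - ((X.filter fun q => dist y q = 1).card : ℝ))) :
    TwoSlabLedgerAt (lam * (Real.sqrt 2 * |⟪A₁ u₁, EuclideanSpace.single (2 : Fin 3) (1 : ℝ)⟫_ℝ|) / 2) A₁ t₁ A₂ t₂ :=
  twoSlabAdhesion_stackLedger_oneSided_pool hs₀ hcert hDS hCP A₁ t₁ A₂ t₂ hz hu₁ hsteep₁ hδ hup M₁ hM₁ hfar hdirs hlam hpool

open scoped Classical in
/-- **`GenericWallFloorAtCharge (λ·½κ₁)` from grain 1 alone, priced** (modulo E1, `StarPairFar`, `hdirs`, `hpool`):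
`λ = 1.70` on the `Σ9` cap centre (`κ₁ = √2·5/6`) is charge `1.00 = c₀`. -/
theorem genericWallFloorAtCharge_oneSided_pool
    {s₀ : EuclideanSpace ℝ (Fin 3)} (hs₀ : s₀ ∈ fccSlots)
    (hcert : ExactOnly 0 (fccSlots.filter fun w => 0 < ⟪w, s₀⟫_ℝ)) (hSP : StarPairFar)
    (A₁ : EuclideanSpace ℝ (Fin 3) ≃ₗᵢ[ℝ] EuclideanSpace ℝ (Fin 3)) (t₁ : EuclideanSpace ℝ (Fin 3))
    (A₂ : EuclideanSpace ℝ (Fin 3) ≃ₗᵢ[ℝ] EuclideanSpace ℝ (Fin 3)) (t₂ : EuclideanSpace ℝ (Fin 3))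
    {z : EuclideanSpace ℝ (Fin 3)} (hz : ‖z‖ = 1)
    {u₁ : EuclideanSpace ℝ (Fin 3)} (hu₁ : u₁ ∈ fccSlots)
    (hsteep₁ : Real.sqrt 2 / 2 ≤ ⟪A₁ u₁, z⟫_ℝ) {δ : ℝ} (hδ : 0 < δ) (hup : δ ≤ (A₁ u₁) 2)
    (M₁ : Set (EuclideanSpace ℝ (Fin 3) ≃ₗᵢ[ℝ] EuclideanSpace ℝ (Fin 3)))
    (hM₁ : ∀ stk : List WalkEntry, StackSound z stk → StackWF z stk → stk.getLast? = some ⟨A₁, u₁, 0⟩ →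
      ∀ e ∈ stk, e.frame ∈ M₁)
    (hfar : ∀ F ∈ M₁, F '' fccStacking 1 (Real.sqrt (2 / 3)) ≠ A₂ '' fccStacking 1 (Real.sqrt (2 / 3)))
    (hdirs : ∀ stk : List WalkEntry, StackSound z stk → StackWF z stk → stk.getLast? = some ⟨A₁, u₁, 0⟩ →
      ∀ e rest, stk = e :: rest → 0 ≤ (e.frame e.dir) 2)
    {lam : ℝ} (hlam : 0 < lam)
    (hpool : ∀ h : ℝ, 0 ≤ h → ∀ ρ : ℝ, 10 ≤ ρ → ∀ X P₁ P₂ : Finset (EuclideanSpace ℝ (Fin 3)),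
      (∀ p ∈ X, ∀ q ∈ X, p ≠ q → 1 ≤ dist p q) → P₁ ⊆ X → P₂ ⊆ X \ P₁ →
      (∀ p ∈ X, -(2 * 10) ≤ p 2 ∧ p 2 ≤ h + 2 * 10 ∧ p 0 ^ 2 + p 1 ^ 2 ≤ ρ ^ 2) →
      (∀ p, p ∈ P₁ ↔ (p ∈ (fun q => A₁ q + t₁) '' fccStacking 1 (Real.sqrt (2 / 3)) ∧
        -(2 * 10) ≤ p 2 ∧ p 2 ≤ -10 ∧ p 0 ^ 2 + p 1 ^ 2 ≤ ρ ^ 2)) →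
      (∀ p, p ∈ P₂ ↔ (p ∈ (fun q => A₂ q + t₂) '' fccStacking 1 (Real.sqrt (2 / 3)) ∧
        h + 10 ≤ p 2 ∧ p 2 ≤ h + 2 * 10 ∧ p 0 ^ 2 + p 1 ^ 2 ≤ ρ ^ 2)) →
      ∀ ES : Finset (EuclideanSpace ℝ (Fin 3) × List WalkEntry),
      (∀ s ∈ ES, s.1 ∈ X ∧ s.1 0 ^ 2 + s.1 1 ^ 2 ≤ (ρ - 2) ^ 2 ∧ (-10 - 2 ≤ s.1 2 ∧ s.1 2 ≤ h + 10 + 2) ∧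
        (X.filter fun q => dist s.1 q = 1).card ≤ 11 ∧ WalkInv X z s ∧ StackWF z s.2 ∧
        s.2.getLast? = some ⟨A₁, u₁, 0⟩ ∧ walkStep X z s = none ∧ (∃ e rest, s.2 = e :: rest ∧ WalkCertified12 X s.1 e) ∧
        (∀ e ∈ s.2, e.frame ∈ M₁)) →
      lam * (ES.card : ℝ) ≤ ∑ y ∈ X.filter (fun y => (X.filter fun q => dist y q = 1).card ≠ 12 ∧ -10 - 2 ≤ y 2 ∧ y 2 ≤ h + 10 + 2),
        ((12 : ℝ) - ((X.filter fun q => dist y q = 1).card : ℝ))) :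
    GenericWallFloorAtCharge (lam * (Real.sqrt 2 * |⟪A₁ u₁, EuclideanSpace.single (2 : Fin 3) (1 : ℝ)⟫_ℝ|) / 2) A₁ t₁ A₂ t₂ :=
  genericWallFloorAtCharge_of_ledger _ A₁ t₁ A₂ t₂
    (twoSlabLedgerAt_oneSided_pool hs₀ hcert (doubleStarCoaxialAt_of_starPairFar hSP) (capPairCoaxial_of_starPairFar hSP)
      A₁ t₁ A₂ t₂ hz hu₁ hsteep₁ hδ hup M₁ hM₁ hfar hdirs hlam hpool)

end Summit.Ventures.Crystal3D.Theorems

end
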